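import Mathlib
import Summits.MatrixMultiplication.MatrixMultiplication.Theses.LevelGradedCohnUmans
import Literature.Computability.AlgebraicComplexity.GroupAlgebraTensor
import Literature.Computability.AlgebraicComplexity.SchoenhageTau
import Literature.Computability.AlgebraicComplexity.AsymptoticSpectrum
import Literature.RepresentationTheory.FiniteGroups.WedderburnBlocks
import Literature.Computability.AlgebraicComplexity.AsymptoticSumInequalityAsymptoticRank
import Literature.Barriers.MatrixMultiplication.UniversalMethodBarrierAsymptoticRank
import Literature.Computability.AlgebraicComplexity.AsymptoticRankLimit
import Literature.Computability.AlgebraicComplexity.CohnUmansTPPProofs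

/-!
# Sketch — crux-ideate `stmt-MatrixMultiplication-7611` (`GradedPricing`), ideator 2, round 1

First lemmas of the two idea cards `separator-restriction-block-simplicity` (1a–1e) and
`asymptotic-rank-sandwich` (2a–2b), stated over existing declarations. Nothing in this file is a
skeleton (no registered stubs); it is ideator evidence.

STATUS (2026-08-16, end of ideator session): PROVED sorry-free — (1a) `sep_tensorRestrictsTo_groupTensor`
(separation is verbatim a restriction of the group tensor), (1b) `twoSidedIdeal_blockAlgebra_eq_subproduct`
(two-sided ideals of `∏ ℂ^{dᵢ×dᵢ}` are coordinate sub-products, via `IsSimpleRing.matrix`),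
(1e) `sum_blockDegrees_rpow_le_finsum_irrChars_inter` (budget bookkeeping),
(2a) `asymptoticRank_matMulDirectSum_le` (`R̃(⊕ᵢ⟨dᵢ,dᵢ,dᵢ⟩) ≤ Σ dᵢ^ω`, elementary route),
(2b) `rpow_omega_le_of_restrictsTo_matMulDirectSum` (the `R̃`-sandwich = BlockAsymptotics for
arbitrary finite row/inner/column types). REMAINING `sorry`: (1c) `character_blockRep_mem_of_readout_ne_zero`
(membership: read-out sees block `i` ⇒ `χᵢ ∈ J`) and (1d) `sep_tensorRestrictsTo_gradedBlocks`
(graded restriction). The composition `gradedPricing_of_sketch : …LevelGradedCohnUmans.GradedPricing`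
type-checks and depends only on (1d) (+ the proved lemmas).
-/

noncomputable section

open scoped BigOperators
open Literature.Computability.AlgebraicComplexity Literature.RepresentationTheory.FiniteGroups
open Literature.Barriers.MatrixMultiplication (asymptoticRank_le_of_polyDegeneratesTo asymptoticRank_le_rpow)

namespace Summit.MatrixMultiplication.MatrixMultiplication.Cruxes.GradedPricing.SketchIdeator2

/-! ## Card `separator-restriction-block-simplicity` -/

/-- (1a) SEPARATION IS A RESTRICTION: the `J`-separation hypothesis of `GradedPricing`, verbatim,
already says `matMulTensorOn ℂ X Y Z ≤ groupTensor ℂ G` along `(x,y) ↦ x⁻¹y`, `(y',z) ↦ y'⁻¹z` and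
the OUTPUT functional `(x₀,z₀) ↦ (k ↦ f_{x₀z₀}(k))` — no TPP clause and no bi-invariance needed. -/
theorem sep_tensorRestrictsTo_groupTensor {G : Type} [Group G] [Fintype G] [DecidableEq G]
    (J : Set (G → ℂ)) (X Y Z : Finset G)
    (hsep : ∀ x₀ ∈ X, ∀ z₀ ∈ Z, ∃ f ∈ J, ∀ x ∈ X, ∀ y ∈ Y, ∀ y' ∈ Y, ∀ z ∈ Z,
      (x = x₀ ∧ y = y' ∧ z = z₀ → f (x⁻¹ * y * y'⁻¹ * z) = 1) ∧
      (¬ (x = x₀ ∧ y = y' ∧ z = z₀) → f (x⁻¹ * y * y'⁻¹ * z) = 0)) :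
    TensorRestrictsTo (groupTensor ℂ G) (matMulTensorOn ℂ X Y Z) := by
  classical
  have hch : ∀ a : ↥X × ↥Z, ∃ f ∈ J, ∀ x ∈ X, ∀ y ∈ Y, ∀ y' ∈ Y, ∀ z ∈ Z,
      (x = a.1 ∧ y = y' ∧ z = a.2 → f (x⁻¹ * y * y'⁻¹ * z) = 1) ∧
      (¬ (x = a.1 ∧ y = y' ∧ z = a.2) → f (x⁻¹ * y * y'⁻¹ * z) = 0) :=
    fun a => hsep a.1 a.1.2 a.2 a.2.2
  choose F _hFJ hF using hch
  refine ⟨fun a k => F a k, fun b g => if g = (b.1 : G)⁻¹ * b.2 then 1 else 0,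
    fun c h => if h = (c.1 : G)⁻¹ * c.2 then 1 else 0, fun a b c => ?_⟩
  -- the triple sum collapses to the single word `x⁻¹ y y'⁻¹ z`
  have hsum : (∑ k, ∑ g, ∑ h, F a k * (if g = (b.1 : G)⁻¹ * b.2 then (1 : ℂ) else 0) *
      (if h = (c.1 : G)⁻¹ * c.2 then (1 : ℂ) else 0) * groupTensor ℂ G k g h) =
      F a ((b.1 : G)⁻¹ * b.2 * (c.1 : G)⁻¹ * c.2) := by
    have inner : ∀ k, (∑ g, ∑ h, F a k * (if g = (b.1 : G)⁻¹ * b.2 then (1 : ℂ) else 0) *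
        (if h = (c.1 : G)⁻¹ * c.2 then (1 : ℂ) else 0) * groupTensor ℂ G k g h) =
        if (b.1 : G)⁻¹ * b.2 * ((c.1 : G)⁻¹ * c.2) = k then F a k else 0 := by
      intro k
      rw [Finset.sum_eq_single ((b.1 : G)⁻¹ * (b.2 : G))]
      · rw [Finset.sum_eq_single ((c.1 : G)⁻¹ * (c.2 : G))]
        · simp [groupTensor_apply]
        · intro h _ hh
          simp [hh]
        · simp
      · intro g _ hg
        exact Finset.sum_eq_zero fun h _ => by simp [hg]
      · simp
    simp_rw [inner]
    rw [Finset.sum_ite_eq, if_pos (Finset.mem_univ _)]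
    congr 1
    simp only [mul_assoc]
  rw [hsum, matMulTensorOn_apply]
  obtain ⟨h1, h0⟩ := hF a b.1 b.1.2 b.2 b.2.2 c.1 c.1.2 c.2 c.2.2
  by_cases hc : (b.1 : G) = a.1 ∧ (b.2 : G) = c.1 ∧ (c.2 : G) = a.2
  · rw [h1 hc, if_pos]
    exact ⟨Subtype.ext hc.1.symm, Subtype.ext hc.2.1, Subtype.ext hc.2.2.symm⟩
  · rw [h0 hc, if_neg]
    rintro ⟨e1, e2, e3⟩
    exact hc ⟨congrArg Subtype.val e1.symm, congrArg Subtype.val e2, congrArg Subtype.val e3.symm⟩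

/-- (1b) FIRST LEMMA of the card: two-sided ideals of the Wedderburn block algebra
`∏ᵢ ℂ^{dᵢ×dᵢ}` are coordinate sub-products (each block `ℂ^{d×d}`, `d ≥ 1`, is a simple ring:
Mathlib `IsSimpleRing.matrix` + `DivisionRing.isSimpleRing`; the units `Pi.single i 1` are
central idempotents). -/
theorem twoSidedIdeal_blockAlgebra_eq_subproduct {r : ℕ} {d : Fin r → ℕ} [∀ i, NeZero (d i)]
    (I : TwoSidedIdeal (BlockAlgebraC d)) :
    ∃ S : Finset (Fin r), ∀ w : BlockAlgebraC d, w ∈ I ↔ ∀ i, i ∉ S → w i = 0 := by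
  classical
  -- `S` = the blocks whose unit lies in `I`
  refine ⟨Finset.univ.filter fun i => (Pi.single i 1 : BlockAlgebraC d) ∈ I, fun w => ?_⟩
  have hunit : ∀ i, (Pi.single i 1 : BlockAlgebraC d) * w = Pi.single i (w i) := fun i => by
    funext j
    rw [Pi.mul_apply]
    by_cases hj : j = i
    · subst hj; simp
    · simp [Pi.single_apply, hj]
  constructor
  · intro hw i hi
    simp only [Finset.mem_filter, Finset.mem_univ, true_and] at hi
    by_contra hne
    -- the slice of `I` in block `i` is a two-sided ideal of the simple ring `ℂ^{dᵢ×dᵢ}`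
    let Ii : TwoSidedIdeal (Matrix (Fin (d i)) (Fin (d i)) ℂ) :=
      TwoSidedIdeal.mk' {M | (Pi.single i M : BlockAlgebraC d) ∈ I}
        (by
          show (Pi.single i (0 : Matrix (Fin (d i)) (Fin (d i)) ℂ) : BlockAlgebraC d) ∈ I
          rw [Pi.single_zero]; exact I.zero_mem)
        (fun {x y} hx hy => by
          show (Pi.single i (x + y) : BlockAlgebraC d) ∈ I
          rw [Pi.single_add]; exact I.add_mem hx hy)
        (fun {x} hx => by
          show (Pi.single i (-x) : BlockAlgebraC d) ∈ I
          rw [Pi.single_neg]; exact I.neg_mem hx)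
        (fun {x y} hy => by
          show (Pi.single i (x * y) : BlockAlgebraC d) ∈ I
          rw [Pi.single_mul]; exact I.mul_mem_left _ _ hy)
        (fun {x y} hx => by
          show (Pi.single i (x * y) : BlockAlgebraC d) ∈ I
          rw [Pi.single_mul]; exact I.mul_mem_right _ _ hx)
    have hIi : ∀ x, x ∈ Ii ↔ (Pi.single i x : BlockAlgebraC d) ∈ I := fun x =>
      TwoSidedIdeal.mem_mk' _ _ _ _ _ _ x
    have hmem : w i ∈ Ii := by
      rw [hIi, ← hunit]; exact I.mul_mem_left _ _ hw
    have h1 : (1 : Matrix (Fin (d i)) (Fin (d i)) ℂ) ∈ Ii :=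
      IsSimpleRing.one_mem_of_ne_zero_mem Ii hne hmem
    exact hi ((hIi 1).1 h1)
  · intro h
    rw [← Finset.univ_sum_single w]
    refine sum_mem fun i _ => ?_
    by_cases hi : (Pi.single i 1 : BlockAlgebraC d) ∈ I
    · have : (Pi.single i (w i) : BlockAlgebraC d) = Pi.single i (w i) * Pi.single i 1 := by
        rw [← Pi.single_mul, mul_one]
      rw [this]
      exact I.mul_mem_left _ _ hi
    · have hz : w i = 0 := h i (by simpa using hi)
      rw [hz, Pi.single_zero]
      exact I.zero_mem

/-- (1c) MEMBERSHIP: if the read-out functional `u ↦ Σ_g u_g f(g)` of some `f ∈ J`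
(`J` bi-invariant) does not vanish on the `i`-th Wedderburn block, then the block character
`χᵢ = tr (φ ·)ᵢ` lies in `J`. (Transport `f ↦ Σ_g f(g) g⁻¹` makes `J` a two-sided ideal of `ℂ[G]`;
apply (1b) through `φ`; the unit of block `i` transports back to `(dᵢ/|G|) χᵢ` by Fourier
inversion at the identity, `card_mul_coeff_one_eq_sum_trace`.) -/
theorem character_blockRep_mem_of_readout_ne_zero {G : Type} [Group G] [Fintype G]
    [DecidableEq G] {r : ℕ} {d : Fin r → ℕ} [∀ i, NeZero (d i)]
    (φ : MonoidAlgebra ℂ G ≃ₐ[ℂ] BlockAlgebraC d)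
    (J : Submodule ℂ (G → ℂ)) (hJ : ∀ f ∈ J, ∀ a b : G, (fun g : G => f (a * g * b)) ∈ J)
    {f : G → ℂ} (hf : f ∈ J) (i : Fin r)
    (hi : ∃ M : Matrix (Fin (d i)) (Fin (d i)) ℂ,
      ∑ g, (φ.symm (Pi.single i M)).coeff g * f g ≠ 0) :
    ((blockRep φ i).character : G → ℂ) ∈ J := by
  sorry

/-- (1d) GRADED RESTRICTION (the algebraic half of `GradedPricing`): with
`S = {i | χᵢ ∈ J}`, `matMulTensorOn ℂ X Y Z ≤ ⊕_{i ∈ S} ⟨dᵢ,dᵢ,dᵢ⟩`: compose (1a) with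
`structureTensor_restrictsTo_of_algEquiv` (the in-tree `J = ⊤` step) and drop the blocks outside
`S`, on which every separator read-out vanishes by (1c). -/
theorem sep_tensorRestrictsTo_gradedBlocks {G : Type} [Group G] [Fintype G] [DecidableEq G]
    {r : ℕ} {d : Fin r → ℕ} [∀ i, NeZero (d i)] (φ : MonoidAlgebra ℂ G ≃ₐ[ℂ] BlockAlgebraC d)
    (J : Submodule ℂ (G → ℂ)) (hJ : ∀ f ∈ J, ∀ a b : G, (fun g : G => f (a * g * b)) ∈ J)
    (X Y Z : Finset G)
    (hsep : ∀ x₀ ∈ X, ∀ z₀ ∈ Z, ∃ f ∈ J, ∀ x ∈ X, ∀ y ∈ Y, ∀ y' ∈ Y, ∀ z ∈ Z,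
      (x = x₀ ∧ y = y' ∧ z = z₀ → f (x⁻¹ * y * y'⁻¹ * z) = 1) ∧
      (¬ (x = x₀ ∧ y = y' ∧ z = z₀) → f (x⁻¹ * y * y'⁻¹ * z) = 0))
    (S : Finset (Fin r)) (hS : ∀ i, i ∈ S ↔ ((blockRep φ i).character : G → ℂ) ∈ J) :
    TensorRestrictsTo
      (matMulDirectSum ℂ (fun j : Fin S.card => d (S.orderEmbOfFin rfl j))
        (fun j => d (S.orderEmbOfFin rfl j)) (fun j => d (S.orderEmbOfFin rfl j)))
      (matMulTensorOn ℂ X Y Z) := by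
  sorry

/-- (1e) BUDGET: the `S`-blocks are distinct irreducible characters lying in `J`
(`character_blockRep_injective`, `isIrreducible_blockRep`, `irrChars_finite_holds`). -/
theorem sum_blockDegrees_rpow_le_finsum_irrChars_inter {G : Type} [Group G] [Fintype G]
    {r : ℕ} {d : Fin r → ℕ} [∀ i, NeZero (d i)] (φ : MonoidAlgebra ℂ G ≃ₐ[ℂ] BlockAlgebraC d)
    (J : Submodule ℂ (G → ℂ)) (S : Finset (Fin r))
    (hS : ∀ i ∈ S, ((blockRep φ i).character : G → ℂ) ∈ J) (s : ℝ) :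
    ∑ i ∈ S, (d i : ℝ) ^ s ≤
      ∑ᶠ χ ∈ irrChars G ∩ (J : Set (G → ℂ)), (χ 1).re ^ s := by
  classical
  have hfin : (irrChars G ∩ (J : Set (G → ℂ))).Finite :=
    (irrChars_finite_holds G).subset Set.inter_subset_left
  rw [finsum_mem_eq_finite_toFinset_sum _ hfin]
  set χ : Fin r → (G → ℂ) := fun i => (blockRep φ i).character with hχ
  have hinj : Function.Injective χ := character_blockRep_injective φ
  have hmem : ∀ i ∈ S, χ i ∈ hfin.toFinset := fun i hi => by
    rw [Set.Finite.mem_toFinset]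
    exact ⟨⟨Fin (d i) → ℂ, inferInstance, inferInstance, inferInstance, blockRep φ i,
      isIrreducible_blockRep φ i, rfl⟩, hS i hi⟩
  have hdeg : ∀ i, ((χ i 1).re : ℝ) = d i := fun i => by
    simp [hχ, Representation.char_one]
  calc ∑ i ∈ S, (d i : ℝ) ^ s = ∑ ψ ∈ S.image χ, (ψ 1).re ^ s := by
        rw [Finset.sum_image fun i _ j _ h => hinj h]
        exact Finset.sum_congr rfl fun i _ => by rw [hdeg]
    _ ≤ ∑ ψ ∈ hfin.toFinset, (ψ 1).re ^ s := by
        refine Finset.sum_le_sum_of_subset_of_nonneg (fun ψ hψ => ?_) (fun ψ hψ _ => ?_)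
        · obtain ⟨i, hi, rfl⟩ := Finset.mem_image.1 hψ
          exact hmem i hi
        · rw [Set.Finite.mem_toFinset] at hψ
          obtain ⟨dψ, -, hdψ⟩ := IsIrrChar.exists_apply_one (G := G) hψ.1
          rw [hdψ]
          exact Real.rpow_nonneg (by simp) _

/-! ## Card `asymptotic-rank-sandwich` -/

/-- (2a) FIRST LEMMA of the card: the upper value `R̃(⊕ᵢ ⟨dᵢ,dᵢ,dᵢ⟩) ≤ Σᵢ dᵢ^ω` — the mirror
image of the in-tree `sum_rpow_omega_le_asymptoticRank` (together: `R̃(⊕ᵢ⟨dᵢ⟩) = Σ dᵢ^ω`).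
Two proofs: Strassen duality `strassen_duality_asymptoticRank_holds` (spectral points are additive
on direct sums and `≤ R̃(⟨d,d,d⟩) = d^ω`, `asymptoticRank_matMulTensor`), or the in-tree word
expansion `kroneckerPow_matMulDirectSum` + `tensorRank_blockPiTensor_le`. -/
theorem asymptoticRank_matMulDirectSum_le {r : ℕ} (d : Fin r → ℕ) [∀ i, NeZero (d i)] :
    asymptoticRank (matMulDirectSum ℂ d d d) ≤ ∑ i, (d i : ℝ) ^ omega ℂ := by
  classical
  -- Route B (elementary): `R(D^{⊗N}) ≤ C_ε (Σ dᵢ^{ω+ε})^N`, `N`-th roots, `N → ∞`, `ε → 0`.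
  set D := matMulDirectSum ℂ d d d with hD
  have hd : ∀ i, (0 : ℝ) < d i := fun i => by exact_mod_cast Nat.pos_of_ne_zero (NeZero.ne _)
  rcases Nat.eq_zero_or_pos r with hr | hr
  · -- no blocks: empty format, `D = 0`
    subst hr
    have hD0 : D = 0 := by
      funext a
      exact a.1.elim0
    rw [hD0, asymptoticRank_zero]
    simp
  haveI : Nonempty (Fin r) := ⟨⟨0, hr⟩⟩
  have hR0 : 0 ≤ asymptoticRank D := asymptoticRank_nonneg D
  refine le_of_forall_pos_le_sum_rpow hd fun ε hε => ?_
  obtain ⟨C, hC, hCk⟩ := exists_tensorRank_matMulTensor_le_rpow ℂ hε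
  set B : ℝ := ∑ i, (d i : ℝ) ^ (omega ℂ + ε) with hB
  have hb : 0 < B :=
    Finset.sum_pos (fun i _ => Real.rpow_pos_of_pos (hd i) _) Finset.univ_nonempty
  refine le_of_pow_le_mul_pow (C := C) hb fun N => ?_
  rcases Nat.eq_zero_or_pos N with hN | hN
  · -- `N = 0`: `1 ≤ C`, from `1 ≤ R(⟨1,1,1⟩) ≤ C · 1^{ω+ε}`
    subst hN
    have h1 : (1 : ℝ) ≤ tensorRank (matMulTensor ℂ 1 1 1) := by
      exact_mod_cast mul_le_tensorRank_matMulTensor ℂ 1 1 1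
    have h2 := hCk 1 le_rfl
    simp only [Nat.cast_one, Real.one_rpow, mul_one] at h2
    simpa using h1.trans h2
  -- `R(D^{⊗N}) ≤ C · B^N` (word expansion of the power of a direct sum, block by block)
  have hDJ : ∀ J : Fin N → Fin r, 1 ≤ ∏ l, d (J l) := fun J =>
    Finset.prod_pos fun l _ => Nat.pos_of_ne_zero (NeZero.ne _)
  have hrank : (tensorRank (kroneckerPow D N) : ℝ) ≤ C * B ^ N := by
    have h1 : tensorRank (kroneckerPow D N) ≤ ∑ J : Fin N → Fin r,
        tensorRank (matMulTensor ℂ (∏ l, d (J l)) (∏ l, d (J l)) (∏ l, d (J l))) := by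
      rw [hD, kroneckerPow_matMulDirectSum]
      exact (tensorRank_sum_le _ _).trans
        (Finset.sum_le_sum fun J _ => tensorRank_blockPiTensor_le ℂ d J)
    have h2 : ∀ J : Fin N → Fin r,
        (tensorRank (matMulTensor ℂ (∏ l, d (J l)) (∏ l, d (J l)) (∏ l, d (J l))) : ℝ) ≤
          C * ∏ l, (d (J l) : ℝ) ^ (omega ℂ + ε) := fun J => by
      refine (hCk _ (hDJ J)).trans_eq ?_
      rw [Nat.cast_prod, Real.finsetProd_rpow _ _ fun l _ => (hd (J l)).le]
    calc (tensorRank (kroneckerPow D N) : ℝ)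
        ≤ ∑ J : Fin N → Fin r,
            (tensorRank (matMulTensor ℂ (∏ l, d (J l)) (∏ l, d (J l)) (∏ l, d (J l))) : ℝ) := by
          exact_mod_cast h1
      _ ≤ ∑ J : Fin N → Fin r, C * ∏ l, (d (J l) : ℝ) ^ (omega ℂ + ε) :=
          Finset.sum_le_sum fun J _ => h2 J
      _ = C * B ^ N := by rw [← Finset.mul_sum, hB, Fintype.sum_pow]
  -- `R̃(D)^N ≤ R(D^{⊗N})` (the asymptotic rank is the infimum of the `N`-th roots)
  have hpow : asymptoticRank D ^ N ≤ (tensorRank (kroneckerPow D N) : ℝ) := by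
    have h := asymptoticRank_le_rpow D hN
    have hN' : (N : ℝ) ≠ 0 := by exact_mod_cast hN.ne'
    have := pow_le_pow_left₀ hR0 h N
    rwa [← Real.rpow_natCast (((tensorRank (kroneckerPow D N) : ℕ) : ℝ) ^ ((N : ℝ)⁻¹)) N,
      ← Real.rpow_mul (Nat.cast_nonneg _), inv_mul_cancel₀ hN', Real.rpow_one] at this
  exact hpow.trans hrank

/-- (2b) THE SANDWICH (= the planner's `BlockAsymptotics`, for arbitrary finite row/column types):
`(|α||β||γ|)^{ω/3} ≤ R̃(⟨|α|,|β|,|γ|⟩) ≤ R̃(⊕ᵢ⟨dᵢ⟩) ≤ Σ dᵢ^ω`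
(`sum_rpow_omega_le_asymptoticRank` with one summand, `asymptoticRank_le_of_polyDegeneratesTo`,
(2a)). -/
theorem rpow_omega_le_of_restrictsTo_matMulDirectSum {r : ℕ} {d : Fin r → ℕ} [∀ i, NeZero (d i)]
    {α β γ : Type} [Fintype α] [Fintype β] [Fintype γ] [DecidableEq α] [DecidableEq β]
    [DecidableEq γ] (h : TensorRestrictsTo (matMulDirectSum ℂ d d d) (matMulTensorOn ℂ α β γ)) :
    ((Fintype.card α * Fintype.card β * Fintype.card γ : ℕ) : ℝ) ^ (omega ℂ / 3) ≤
      ∑ i, (d i : ℝ) ^ omega ℂ := by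
  classical
  -- the one-summand direct sum `⊕_{Fin 1} ⟨|α|,|β|,|γ|⟩` is a relabelling of `matMulTensorOn ℂ α β γ`
  have hres : TensorRestrictsTo (matMulTensorOn ℂ α β γ)
      (matMulDirectSum ℂ (fun _ : Fin 1 => Fintype.card α) (fun _ => Fintype.card β)
        (fun _ => Fintype.card γ)) := by
    set eα := Fintype.equivFin α
    set eβ := Fintype.equivFin β
    set eγ := Fintype.equivFin γ
    have key : matMulDirectSum ℂ (fun _ : Fin 1 => Fintype.card α) (fun _ => Fintype.card β)
        (fun _ => Fintype.card γ) =
        fun x y z => matMulTensorOn ℂ α β γ (eα.symm x.2.1, eγ.symm x.2.2)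
          (eα.symm y.2.1, eβ.symm y.2.2) (eβ.symm z.2.1, eγ.symm z.2.2) := by
      funext x y z
      simp only [matMulDirectSum, matMulTensorOn_apply]
      refine ite_congr_prop ?_
      simp only [Subsingleton.elim x.1 y.1, Subsingleton.elim y.1 z.1, true_and, Fin.ext_iff,
        Equiv.apply_eq_iff_eq]
    rw [key]
    exact tensorRestrictsTo_precomp _ _ _ _
  have h1 := sum_rpow_omega_le_asymptoticRank ℂ (fun _ : Fin 1 => Fintype.card α)
    (fun _ => Fintype.card β) (fun _ => Fintype.card γ)
  simp only [Finset.univ_unique, Finset.sum_singleton] at h1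
  have h2 : asymptoticRank (matMulDirectSum ℂ (fun _ : Fin 1 => Fintype.card α)
      (fun _ => Fintype.card β) (fun _ => Fintype.card γ)) ≤
      asymptoticRank (matMulTensorOn ℂ α β γ) :=
    asymptoticRank_le_of_polyDegeneratesTo hres.polyDegeneratesTo
  have h3 : asymptoticRank (matMulTensorOn ℂ α β γ) ≤ asymptoticRank (matMulDirectSum ℂ d d d) :=
    asymptoticRank_le_of_polyDegeneratesTo h.polyDegeneratesTo
  exact h1.trans (h2.trans (h3.trans (asymptoticRank_matMulDirectSum_le d)))

/-! ## How the two halves meet the crux BY NAME (statement-level check only; proof = the line) -/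

example : Summit.MatrixMultiplication.MatrixMultiplication.Theses.LevelGradedCohnUmans.GradedPricing =
    (∀ (G : Type) [Group G] [Fintype G] (J : Submodule ℂ (G → ℂ)),
      (∀ f ∈ J, ∀ a b : G, (fun g : G => f (a * g * b)) ∈ J) → ∀ X Y Z : Finset G,
      (∀ x₀ ∈ X, ∀ z₀ ∈ Z, ∃ f ∈ J, ∀ x ∈ X, ∀ y ∈ Y, ∀ y' ∈ Y, ∀ z ∈ Z,
        (x = x₀ ∧ y = y' ∧ z = z₀ → f (x⁻¹ * y * y'⁻¹ * z) = 1) ∧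
        (¬ (x = x₀ ∧ y = y' ∧ z = z₀) → f (x⁻¹ * y * y'⁻¹ * z) = 0)) →
      ((X.card * Y.card * Z.card : ℕ) : ℝ) ^ (Literature.Computability.AlgebraicComplexity.omega ℂ / 3) ≤
        ∑ᶠ χ ∈ Literature.RepresentationTheory.FiniteGroups.irrChars G ∩ (J : Set (G → ℂ)),
          (χ 1).re ^ Literature.Computability.AlgebraicComplexity.omega ℂ) := rfl

/-- COMPOSITION CHECK (private to this sketch, not a skeleton): the stubs (1c)+(1d)+(1e) of card 1
and the sandwich (2b) of card 2 (itself proved above from (2a) and the tree) conclude the crux BY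
NAME. -/
theorem gradedPricing_of_sketch :
    Summit.MatrixMultiplication.MatrixMultiplication.Theses.LevelGradedCohnUmans.GradedPricing := by
  intro G _ _ J hJ X Y Z hsep
  classical
  obtain ⟨r, d, hd, ⟨φ⟩⟩ := exists_algEquiv_pi_matrix G
  haveI := hd
  set S : Finset (Fin r) :=
    Finset.univ.filter (fun i => ((blockRep φ i).character : G → ℂ) ∈ J) with hSdef
  have hS : ∀ i, i ∈ S ↔ ((blockRep φ i).character : G → ℂ) ∈ J := fun i => by simp [hSdef]
  have hres := sep_tensorRestrictsTo_gradedBlocks φ J hJ X Y Z hsep S hS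
  have h2 := rpow_omega_le_of_restrictsTo_matMulDirectSum hres
  have hsum : ∑ j : Fin S.card, ((d (S.orderEmbOfFin rfl j) : ℕ) : ℝ) ^ omega ℂ =
      ∑ i ∈ S, (d i : ℝ) ^ omega ℂ := by
    rw [← Finset.sum_coe_sort S]
    exact Fintype.sum_equiv (S.orderIsoOfFin rfl).toEquiv _ _ fun j => by
      simp only [RelIso.coe_fn_toEquiv, Finset.coe_orderIsoOfFin_apply]
  have h3 := sum_blockDegrees_rpow_le_finsum_irrChars_inter φ J S (fun i hi => (hS i).1 hi)
    (omega ℂ)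
  simp only [Fintype.card_coe] at h2
  rw [hsum] at h2
  exact h2.trans h3

end Summit.MatrixMultiplication.MatrixMultiplication.Cruxes.GradedPricing.SketchIdeator2

end
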